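import Mathlib
import HarnessLib
import Summits.ResolutionOfSingularities.ResolutionOfSingularities.Theorems.WildQuotientsWildQuotientResolutionS1aA1KillsIn
import Summits.ResolutionOfSingularities.ResolutionOfSingularities.Theorems.WildQuotientsWildQuotientResolutionS1aD4Move2
import Summits.ResolutionOfSingularities.ResolutionOfSingularities.Theorems.WildQuotientsWildQuotientResolutionS1aD4Move2Node
import Summits.ResolutionOfSingularities.ResolutionOfSingularities.Theorems.WildQuotientsWildQuotientResolutionS1aD4KillLeaf2

/-!
# S1a — INSTANCE I-3 (D₄) CLOSED ON THE FRAME: `KillsIn 4` for the initial model of the D₄ datum, and the conclusion of `ReachLowerInF(X)` for every root decoration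

[OURS · L1 W4.5c · lead-1 g13; plan-1 RULING R-F15e (I-3 = `KillsIn 4 (initial)` on MT-D₄ v1.1: σ: x₁↦x₁+x₀, x₂↦x₂+x₀, x₃↦x₃+x₁x₂(x₁−x₂); any p),
X-CERT v1.1 §2 / v1.2-D4ROWS, NOTES `D4 TREE OF RECORD`; pattern of ✓`…S1aA1KillsIn`] — NOT statements of the manuscript; counted 0; AI-level work, weaker than
expert review. Crux stmt-ResolutionOfSingularities-17941 `CyclicQuotientFourfolds`, line `s1a-logminvertex` v13 (`stub_reachLowerInFX`).

* ★★★ `GameFrame.GModel.d4_killsIn_four` — for the D₄ datum (`X′` affine regular with `Γ(X′,⊤) ≃ k[x₀..x₃]` intertwining `g₀` with `σ`, `char k = p`):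
  `KillsIn 4 (GModel.initial hq h₀)` — move 1 (x₀:2, x₁:1) assembled inline (✓`exists_isAdmissibleCentre_of_chartData` with ✓`D4.d4_map_le`, the `[x₀]₂` chart
  killed by the residual section of ✓`D4.d4_u'_zero_mem_residual`, cover / norm / pins by name from the a1 files), the node of `N(x₁)` modelled in the
  re-coordinated form through ✓`exists_d4NormChartModel`, then ✓`d4_move2` and ✓`d4_killsIn_two` (moves 3, 4 via ✓`d4_move3`, ✓`d4_killsIn_one`, ✓`d4_move4`);
* ★★★ `GameFrame.GModel.exists_reachLowerF_initial_of_d4` — INSTANCE I-3 OF RECORD: for every root decoration `𝔄₀` of the initial model the conclusion of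
  `ReachLowerInF(X)` holds (✓`exists_reachLowerF_of_killsIn_datum`). Third inhabited datum class of `S1.ReachLowerInFX p` after J₄ ✓p660379 and a1 ✓p687171.
-/

set_option linter.dupNamespace false

noncomputable section

open CategoryTheory Limits AlgebraicGeometry TopologicalSpace Topology Opposite MvPolynomial
open Literature.AlgebraicGeometry.Resolution Literature.AlgebraicGeometry.RelativeSpec
open scoped LaurentPolynomial
open Summit.ResolutionOfSingularities.ResolutionOfSingularities.Theorems.WildQuotientResolution.S1
open Summit.ResolutionOfSingularities.ResolutionOfSingularities.Theorems.WildQuotientResolution.S1.NodeAtlas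
open Summit.ResolutionOfSingularities.ResolutionOfSingularities.Theorems.WildQuotientResolution.S1.CoarseChart
open Summit.ResolutionOfSingularities.ResolutionOfSingularities.Theorems.WildQuotientResolution.S1.ProducerStep
open Summit.ResolutionOfSingularities.ResolutionOfSingularities.Theorems.WildQuotientResolution.S1.NpFrame
open Summit.ResolutionOfSingularities.ResolutionOfSingularities.Theorems.WildQuotientResolution.S1.GoodCharts
open Summit.ResolutionOfSingularities.ResolutionOfSingularities.Theorems.WildQuotientResolution.S1.BlowupCharts
open Summit.ResolutionOfSingularities.ResolutionOfSingularities.Theorems.WildQuotientResolution.S1.KillableTransport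
open Summit.ResolutionOfSingularities.ResolutionOfSingularities.Theorems.WildQuotientResolution.S1.KillCert
open Summit.ResolutionOfSingularities.ResolutionOfSingularities.Theorems.WildQuotientResolution.S1.ReesBigrading
open Summit.ResolutionOfSingularities.ResolutionOfSingularities.Theorems.WildQuotientResolution.S1.NodeTransport
open Summit.ResolutionOfSingularities.ResolutionOfSingularities.Theorems.WildQuotientResolution.S1.CobordantTransport
open Summit.ResolutionOfSingularities.ResolutionOfSingularities.Theorems.WildQuotientResolution.BlowupExit
open Summit.ResolutionOfSingularities.ResolutionOfSingularities.Theorems.WildQuotientResolution.S1.KillGlue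
open Summit.ResolutionOfSingularities.ResolutionOfSingularities.Theorems.WildQuotientResolution.S1.FreeModel
open Summit.ResolutionOfSingularities.ResolutionOfSingularities.Theorems.WildQuotientResolution.S1.ModelNode

namespace Summit.ResolutionOfSingularities.ResolutionOfSingularities.Theorems.WildQuotientResolution.S1.GameFrame.GModel

variable {p : ℕ} {X' X₁ : Scheme.{0}} {q : X' ⟶ X₁} {G : Type} [Group G] {ρ : G →* Aut X'} {g₀ : G}

/-- ★ **MOVE 1 OF MT-D₄ IS A LEGAL MOVE, with the explicit root node.** On the initial model of the D₄ datum, a stable affine chart `O` (meant: `O = X′`)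
whose ring of sections is `≃ k[x₀..x₃]` by `e`, with `g₀` acting through `e` as the D₄ automorphism `σ` and `V(e⁻¹x₀, e⁻¹x₁) ∩ O` closed: the (2,1)-centre
`(e⁻¹x₀, e⁻¹x₁)` (node: sections ring, trivial grading, `σ = actOEquiv g₀`, tautological `e′`) yields a Veronese degree `d` and an ADMISSIBLE `G`-stable
centre `𝒦` with `O` a centre chart and `(𝒦|O)_n = e′⁻¹(trace 𝒥ₙ)`. [OURS · L1 W4.5c · R-F15e move 1] -/
theorem d4_rootChartData [Finite G] (hp : p.Prime) (hG : ∀ g : G, g ∈ Subgroup.zpowers g₀) (hg₀ : g₀ ^ p = 1)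
    (hq : ∀ g : G, (ρ g).hom ≫ q = q) [IsIntegral X'] [IsLocallyNoetherian X'] [X'.IsSeparated]
    (hreg : Scheme.IsRegular X') {k : Type} [Field k] (σ : MvPolynomial (Fin 4) k ≃+* MvPolynomial (Fin 4) k) (hC : ∀ a : k, σ (C a) = C a)
    (h0 : σ (X 0) = X 0) (h1 : σ (X 1) = X 1 + X 0) (h2 : σ (X 2) = X 2 + X 0) (h3 : σ (X 3) = X 3 + X 1 * (X 2 * (X 1 - X 2)))
    (h₀ : NodeAtlas p (⟨ρ, hq⟩ : ActionOver q G) g₀) (O : (GModel.initial (p := p) (g₀ := g₀) hq h₀).act.StableAffineOpens) (hO : IsAffineOpen O.1)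
    (e : Γ(X', O.1) ≃+* MvPolynomial (Fin 4) k) (hact : ∀ t : Γ(X', O.1), actOEquiv (GModel.initial hq h₀).act O g₀ t = e.symm (σ (e t)))
    (hZcl : IsClosed (X'.zeroLocus (U := O.1) (Set.range (e.symm ∘ ![X 0, X 1] : Fin 2 → Γ(X', O.1))) ∩ (O.1 : Set (GModel.initial (p := p) (g₀ := g₀) hq h₀).V))) :
    ∃ (𝒜 : (Π j : Fin 0, ZMod ((![] : Fin 0 → ℕ) j)) → AddSubgroup Γ(X', O.1)) (_ : GradedRing 𝒜) (e' : Γ(X', O.1) ≃+* ↥(𝒜 0))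
      (𝒦 : ReesFiltration X') (d : ℕ),
      (∀ i, 𝒜 i = ⊤) ∧ (∀ b, ((e' b : ↥(𝒜 0)) : Γ(X', O.1)) = b) ∧
      IsTameNode p Γ(X', O.1) 𝒜 (actOEquiv (GModel.initial hq h₀).act O g₀) ∧ (∀ x, (⇑(actOEquiv (GModel.initial hq h₀).act O g₀))^[p] x = x) ∧
      (∀ t : Γ(X', O.1), ((e' (((GModel.initial hq h₀).act.aut g₀⁻¹).hom.appLE O.1 O.1 (O.2.1 g₀⁻¹).ge t) : ↥(𝒜 0)) : Γ(X', O.1)) =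
        actOEquiv (GModel.initial hq h₀).act O g₀ ((e' t : ↥(𝒜 0)) : Γ(X', O.1))) ∧
      VeroneseNormalised 𝒜 (e.symm ∘ ![X 0, X 1]) ![2, 1] d ∧
      IsAdmissibleCentre p (GModel.initial hq h₀).act g₀ 𝒦 d ∧ IsCentreChart p (GModel.initial hq h₀).act g₀ 𝒦 d O ∧
      (∀ (g : G) (n : ℕ), (𝒦.ideal n).comap ((GModel.initial hq h₀).act.aut g).hom = 𝒦.ideal n) ∧
      (∀ n, (𝒦.filtration ⟨O.1, hO⟩).ideal n = ((traceFiltration 𝒜 (e.symm ∘ ![X 0, X 1]) ![2, 1]).ideal n).comap (e' : Γ(X', O.1) →+* ↥(𝒜 0))) ∧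
      (((𝒦.ideal d).support : Set X')) = X'.zeroLocus (U := O.1) (Set.range (e.symm ∘ ![X 0, X 1] : Fin 2 → Γ(X', O.1))) ∩ (O.1 : Set (GModel.initial (p := p) (g₀ := g₀) hq h₀).V) := by
  haveI hsep : (GModel.initial (p := p) (g₀ := g₀) hq h₀).V.IsSeparated := ‹X'.IsSeparated›
  have hp1 := hp.pos
  obtain ⟨𝒜, gr, e', 𝒦, d, h𝒜, he', htame, hσp, hσ, -, hver, hadm, hcentre, hG𝒦, -, h𝒦tr, hsupp⟩ :=
    exists_isAdmissibleCentre_of_chartData (p := p) hG hg₀ (GModel.initial hq h₀) hreg O hO (e.symm ∘ ![X 0, X 1]) ![2, 1] (by norm_num)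
      (fun i => by fin_cases i <;> norm_num) (A1.a1_isRegular e) (A1.a1_isRegularRing_quotient e)
      (D4.d4_map_le σ hC h0 h1 h2 (X 2 * (X 1 - X 2)) h3 e (actOEquiv (GModel.initial hq h₀).act O g₀) hact) hZcl
  exact ⟨𝒜, gr, e', 𝒦, d, h𝒜, he', htame, hσp, hσ, hver, hadm, hcentre, hG𝒦, h𝒦tr, hsupp⟩

set_option maxHeartbeats 4000000 in
set_option synthInstance.maxHeartbeats 400000 in
/-- ★★★ **`KillsIn 4` FOR THE INITIAL MODEL OF THE D₄ DATUM** (MT-D₄ v1.1: four admissible moves, every depth-4 realisation carries a node atlas with empty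
formal locus). See the module docstring. [OURS · L1 W4.5c · R-F15e I-3; NOT a statement of the manuscript] -/
theorem d4_killsIn_four [Finite G] (hp : p.Prime) (hG : ∀ g : G, g ∈ Subgroup.zpowers g₀) (hg₀ : g₀ ^ p = 1)
    (hq : ∀ g : G, (ρ g).hom ≫ q = q) [IsIntegral X'] [IsLocallyNoetherian X'] [X'.IsSeparated] [IsAffine X']
    (hreg : Scheme.IsRegular X') {k' : Type} [Field k'] (φ : X₁ ⟶ Spec (.of k')) [IsSeparated φ] [IsFinite q]
    {k : Type} [Field k] [CharP k p] (σ : MvPolynomial (Fin 4) k ≃+* MvPolynomial (Fin 4) k) (hC : ∀ a : k, σ (C a) = C a)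
    (h0 : σ (X 0) = X 0) (h1 : σ (X 1) = X 1 + X 0) (h2 : σ (X 2) = X 2 + X 0) (h3 : σ (X 3) = X 3 + X 1 * (X 2 * (X 1 - X 2)))
    (e : Γ(X', ⊤) ≃+* MvPolynomial (Fin 4) k)
    (hστ : ∀ t : Γ(X', ⊤), e ((ρ g₀⁻¹).hom.appLE ⊤ ⊤ (by rw [Scheme.Hom.preimage_top]) t) = σ (e t))
    (h₀ : NodeAtlas p (⟨ρ, hq⟩ : ActionOver q G) g₀) :
    KillsIn 4 (GModel.initial (p := p) (g₀ := g₀) hq h₀) := by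
  classical
  haveI : NeZero p := ⟨hp.ne_zero⟩
  have hp1 : p ≠ 1 := hp.one_lt.ne'
  -- the root chart `O = X′`
  haveI : IsAffine (⊤ : X'.Opens) := isAffineOpen_top X'
  have hAff : IsAffineHom ((⊤ : X'.Opens).ι ≫ q) := inferInstance
  have hst : ∀ g : G, (ρ g).hom ⁻¹ᵁ (⊤ : X'.Opens) = ⊤ := fun g => Scheme.Hom.preimage_top _
  let O : (GModel.initial (p := p) (g₀ := g₀) hq h₀).act.StableAffineOpens := ⟨⊤, hst, hAff⟩
  have hO : IsAffineOpen O.1 := isAffineOpen_top X'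
  haveI hsep₀ : (GModel.initial (p := p) (g₀ := g₀) hq h₀).V.IsSeparated := ‹X'.IsSeparated›
  -- `e` read on `Γ(X′, O)` (definitionally `Γ(X′, ⊤)`), kept opaque
  obtain ⟨e₀, he₀⟩ : ∃ e₀ : Γ(X', O.1) ≃+* MvPolynomial (Fin 4) k, ∀ t, e₀ t = e t := ⟨e, fun _ => rfl⟩
  have he₀s : ∀ x, e₀.symm x = e.symm x := fun x => e₀.injective (by rw [e₀.apply_symm_apply, he₀, e.apply_symm_apply])
  have hact : ∀ t : Γ(X', O.1), actOEquiv (GModel.initial hq h₀).act O g₀ t = e₀.symm (σ (e₀ t)) := fun t => by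
    apply e₀.injective
    rw [e₀.apply_symm_apply, he₀, he₀, ← hστ]
    rfl
  have hZcl : IsClosed (X'.zeroLocus (U := O.1) (Set.range (e₀.symm ∘ ![X 0, X 1] : Fin 2 → Γ(X', O.1))) ∩
      (O.1 : Set (GModel.initial (p := p) (g₀ := g₀) hq h₀).V)) :=
    (X'.zeroLocus_isClosed _).inter (by exact isClosed_univ)
  obtain ⟨𝒜, gr, e', 𝒦, d, h𝒜, he', htame, hσp, hσ, hver, hadm, -, hG𝒦, h𝒦tr, -⟩ :=
    d4_rootChartData hp hG hg₀ hq hreg σ hC h0 h1 h2 h3 h₀ O hO e₀ hact hZcl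
  letI : GradedRing 𝒜 := gr
  -- the root automorphism, kept opaque
  obtain ⟨τ₀, hτ₀⟩ : ∃ τ₀ : Γ(X', O.1) ≃+* Γ(X', O.1), τ₀ = actOEquiv (GModel.initial hq h₀).act O g₀ := ⟨_, rfl⟩
  have hact₀ : ∀ t : Γ(X', O.1), τ₀ t = e₀.symm (σ (e₀ t)) := fun t => by rw [hτ₀]; exact hact t
  have htame₀ : IsTameNode p Γ(X', O.1) 𝒜 τ₀ := by rw [hτ₀]; exact htame
  have hσp₀ : ∀ x : Γ(X', O.1), (⇑τ₀)^[p] x = x := by rw [hτ₀]; exact hσp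
  have hσ₀ : ∀ t : Γ(X', O.1), ((e' (((GModel.initial hq h₀).act.aut g₀⁻¹).hom.appLE O.1 O.1 (O.2.1 g₀⁻¹).ge t) : ↥(𝒜 0)) : Γ(X', O.1)) =
      τ₀ ((e' t : ↥(𝒜 0)) : Γ(X', O.1)) := fun t => by rw [hτ₀]; exact hσ t
  refine ⟨𝒦, d, hadm, fun M₁ hm₁ => ⟨⟨NodeAtlasData.ofNodeAtlas (p := p) (ρ := M₁.act) (g₀ := g₀) M₁.atlas⟩, ?_⟩⟩
  obtain ⟨π₁, hbl, -, hr, hcomm⟩ := hm₁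
  haveI : M₁.V.IsSeparated := isSeparated_of_datum φ M₁
  -- ### MOVE 1 on the realisation `M₁`: the norm charts and the atlas `𝔄₁`
  haveI hchar : CharP Γ(X', O.1) p := charP_of_injective_ringHom (f := e₀.symm.toRingHom) e₀.symm.injective p
  have hd : 0 < d := hver.1
  have hdp : 0 < d * p := Nat.mul_pos hd hp.pos
  have hdbar : 0 < d * (2 * p) := Nat.mul_pos hd (Nat.mul_pos two_pos hp.pos)
  have hf := a1_hf hq h₀ O e₀ 𝒜 h𝒜
  have hσJ := D4.d4_map_le σ hC h0 h1 h2 (X 2 * (X 1 - X 2)) h3 e₀ τ₀ hact₀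
  have hw : ∀ i, 0 < (![2, 1] : Fin 2 → ℕ) i := fun i => by fin_cases i <;> norm_num
  have hK1 := A1.a1_isRegular e₀
  have hK1' := A1.a1_isRegularRing_quotient e₀
  have hk : 0 < 2 * p := Nat.mul_pos two_pos hp.pos
  -- the cover, kept opaque
  obtain ⟨a₀, ha₀⟩ : ∃ a : Γ(X', O.1), a = e₀.symm (X 0) ^ (d * p) := ⟨_, rfl⟩
  obtain ⟨a₁, ha₁⟩ : ∃ a : Γ(X', O.1), a = (∏ i : ZMod p, (e₀.symm (X 1) + (i.val : Γ(X', O.1)) * e₀.symm (X 0))) ^ (2 * d) := ⟨_, rfl⟩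
  obtain ⟨y, hy0, hy1⟩ : ∃ y : Fin 2 → ↥(𝒜 0), y 0 = e' a₀ ∧ y 1 = e' a₁ := ⟨![e' a₀, e' a₁], rfl, rfl⟩
  have hyval : ∀ j, (y j).1 = (![a₀, a₁] : Fin 2 → Γ(X', O.1)) j := fun j => by
    fin_cases j
    · change (y 0).1 = a₀; rw [hy0]; exact he' a₀
    · change (y 1).1 = a₁; rw [hy1]; exact he' a₁
  have hy : ∀ j, y j ∈ (traceFiltration 𝒜 (e₀.symm ∘ ![X 0, X 1]) ![2, 1]).ideal (d * (2 * p)) := fun j => by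
    rw [mem_traceFiltration_iff, hyval]
    fin_cases j
    · change a₀ ∈ _; rw [ha₀]; exact A1.a1_cover_zero_mem e₀ d
    · change a₁ ∈ _; rw [ha₁]; exact A1.a1_cover_one_mem e₀ d
  have hσy : ∀ j, τ₀ (y j).1 = (y j).1 := fun j => by
    rw [hyval]
    fin_cases j
    · change τ₀ a₀ = a₀; rw [ha₀]; exact A1.a1_cover_zero_fixed σ h0 e₀ τ₀ hact₀ d
    · change τ₀ a₁ = a₁; rw [ha₁]; exact A1.a1_cover_one_fixed σ h0 h1 e₀ τ₀ hact₀ hp1 d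
  have hrad : ∀ i : Fin 2, cobordantAlgebra.u' (e₀.symm ∘ ![X 0, X 1]) ![2, 1] i ∈
      (Ideal.span (Set.range fun j => coverElement 𝒜 (e₀.symm ∘ ![X 0, X 1]) ![2, 1] (d * (2 * p)) (y j) (hy j))).radical := by
    intro i
    have h := A1.a1_hrad e₀ (p := p) d (coverElement 𝒜 (e₀.symm ∘ ![X 0, X 1]) ![2, 1] (d * (2 * p)) (y 0) (hy 0))
      (coverElement 𝒜 (e₀.symm ∘ ![X 0, X 1]) ![2, 1] (d * (2 * p)) (y 1) (hy 1)) (by rw [coe_coverElement, hyval, ← ha₀]; rfl)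
      (by rw [coe_coverElement, hyval, ← ha₁]; rfl) i
    refine Ideal.radical_mono (Ideal.span_mono ?_) h
    exact Set.insert_subset_iff.mpr ⟨⟨0, rfl⟩, Set.singleton_subset_iff.mpr ⟨1, rfl⟩⟩
  have hH1 := D4.d4_augmentationIdeal_sigmaR_le σ hC h0 h1 h2 (X 2 * (X 1 - X 2)) h3 e₀ τ₀ hact₀ hp.pos hσp₀
  have hmem0 := D4.d4_u'_zero_mem_residual σ hC h0 h1 h2 (X 2 * (X 1 - X 2)) h3 e₀ τ₀ hact₀ hp.pos hσp₀
  have hz := fun j => A1.a1_residualSection_zero e₀ ![] 𝒜 hf (y j) (hy j) d rfl _ hmem0 hdp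
  have hsuppO : (((𝒦.ideal d).support : Set X')) ⊆ (O.1 : Set (GModel.initial (p := p) (g₀ := g₀) hq h₀).V) :=
    fun x _ => Set.mem_univ x
  obtain ⟨OW, hOWaff, hOWeq, E, htame', hE, hpin, 𝔄₁, hF₁⟩ := exists_moveAtlas_of_node hp.pos hG (GModel.initial hq h₀) M₁ (NodeAtlasData.ofNodeAtlas (p := p) (ρ := (⟨ρ, hq⟩ : ActionOver q G)) (g₀ := g₀) h₀) O hO
    ![] 𝒜 (e₀.symm ∘ ![X 0, X 1]) ![2, 1] hf τ₀ e' htame₀ hσp₀ hσ₀ hw hK1 hK1' hσJ 𝒦 d hG𝒦 h𝒦tr hver hsuppO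
    π₁ hbl hr hcomm hk y hy hσy hrad (cobordantAlgebra.s (e₀.symm ∘ ![X 0, X 1]) ![2, 1]) hH1 (fun _ => 1)
    (fun j => ![algebraMap _ (ChartRing 𝒜 (e₀.symm ∘ ![X 0, X 1]) ![2, 1] (d * (2 * p)) (y j) (hy j))
        (cobordantAlgebra.u' (e₀.symm ∘ ![X 0, X 1]) ![2, 1] 0 ^ (d * p)) *
      IsLocalization.Away.invSelf (coverElement 𝒜 (e₀.symm ∘ ![X 0, X 1]) ![2, 1] (d * (2 * p)) (y j) (hy j))])
    (fun j l => by fin_cases l; exact (hz j).1) (fun j l => by fin_cases l; exact (hz j).2)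
  have hWle : ∀ j, (OW j).1 ≤ π₁ ⁻¹ᵁ O.1 := fun j => by rw [hOWeq j]; exact blowupChart_le_preimage π₁ _ ⟨O.1, hO⟩ _
  -- chart 0 is killed: its residual section is `1`
  have hc0 : coverElement 𝒜 (e₀.symm ∘ ![X 0, X 1]) ![2, 1] (d * (2 * p)) (y 0) (hy 0) = cobordantAlgebra.u' (e₀.symm ∘ ![X 0, X 1]) ![2, 1] 0 ^ (d * p) := by
    refine Subtype.ext ?_
    rw [coe_coverElement, SubmonoidClass.coe_pow, cobordantAlgebra.coe_u', hyval]
    change LaurentPolynomial.C a₀ * _ = (LaurentPolynomial.C (e₀.symm (X 0)) * LaurentPolynomial.T ((2 : ℕ) : ℤ)) ^ (d * p)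
    rw [ha₀, mul_pow, map_pow, LaurentPolynomial.T_pow]
    congr 2
    push_cast
    ring
  have hunit0 : algebraMap _ (ChartRing 𝒜 (e₀.symm ∘ ![X 0, X 1]) ![2, 1] (d * (2 * p)) (y 0) (hy 0))
        (cobordantAlgebra.u' (e₀.symm ∘ ![X 0, X 1]) ![2, 1] 0 ^ (d * p)) *
      IsLocalization.Away.invSelf (coverElement 𝒜 (e₀.symm ∘ ![X 0, X 1]) ![2, 1] (d * (2 * p)) (y 0) (hy 0)) = 1 := by
    rw [← hc0]; exact IsLocalization.Away.mul_invSelf _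
  have hz0W : ∀ v ∈ (OW 0).1, v ∈ M₁.V.basicOpen
      (letI := chartNodeGradedRing ![] 𝒜 (e₀.symm ∘ ![X 0, X 1]) ![2, 1] hf (d * (2 * p)) (y 0) (hy 0); (E 0).symm ⟨_, (hz 0).1⟩) := fun v hv => by
    letI := chartNodeGradedRing ![] 𝒜 (e₀.symm ∘ ![X 0, X 1]) ![2, 1] hf (d * (2 * p)) (y 0) (hy 0)
    have h1 : (⟨_, (hz 0).1⟩ : ↥(chartNodeGrading ![] 𝒜 (e₀.symm ∘ ![X 0, X 1]) ![2, 1] hf (d * (2 * p)) (y 0) (hy 0) 0)) = 1 := Subtype.ext hunit0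
    rw [h1, map_one, Scheme.basicOpen_of_isUnit _ isUnit_one]
    exact hv
  have hF₁W : 𝔄₁.fLocus ⊆ ((OW 1).1 : Set M₁.V) := by
    intro v hv
    rcases hF₁ hv with hold | hnew
    · exact absurd (Set.mem_univ _) hold.2
    · obtain ⟨j, hvW, hvR⟩ := Set.mem_iUnion.mp hnew
      revert hvW hvR
      refine Fin.cases ?_ (fun j' => Fin.cases ?_ (fun j'' => j''.elim0) j') j
      · intro hvW hvR
        exact absurd (hz0W v hvW) (hvR 0)
      · intro hvW _
        exact hvW
  letI instN := chartNodeGradedRing ![] 𝒜 (e₀.symm ∘ ![X 0, X 1]) ![2, 1] hf (d * (2 * p)) (y 1) (hy 1)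
  have hπ' : IsBlowup π₁ ((𝒦.ideal d) ^ (2 * p)) := isBlowup_pow hbl hk.ne'
  have hverbar := CoarseChart.veroneseNormalised_mul 𝒜 _ _ hver hk
  have hJ' : ((𝒦.ideal d) ^ (2 * p)).ideal ⟨O.1, hO⟩ = ((traceFiltration 𝒜 (e₀.symm ∘ ![X 0, X 1]) ![2, 1]).ideal (d * (2 * p))).comap (e' : Γ(X', O.1) →+* ↥(𝒜 0)) := by
    rw [Scheme.IdealSheafData.ideal_pow, Pi.pow_apply, ← ReesFiltration.filtration_ideal, h𝒦tr d, hver.2 (2 * p), comap_equiv_pow]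
  have hxJ1 : e'.symm (y 1) ∈ ((𝒦.ideal d) ^ (2 * p)).ideal ⟨O.1, hO⟩ := by
    rw [hJ', Ideal.mem_comap, RingHom.coe_coe, e'.apply_symm_apply]; exact hy 1
  have hcovM : ∀ x : M₁.V, x ∈ (OW 0).1 ∨ x ∈ (OW 1).1 := by
    intro x
    have hcovW := iSup_blowupChart_eq_preimage (I := 𝒦.ideal d) (GModel.initial hq h₀).act ![] 𝒜 (e₀.symm ∘ ![X 0, X 1]) ![2, 1] hf O hO e' hπ' hverbar hJ' y hy hrad
    have hx : x ∈ ⨆ j, blowupChart π₁ ((𝒦.ideal d) ^ (2 * p)) ⟨O.1, hO⟩ (e'.symm (y j)) :=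
      (congrArg (fun U : M₁.V.Opens => x ∈ U) hcovW).mpr (Set.mem_univ _)
    obtain ⟨j, hj⟩ := Opens.mem_iSup.mp hx
    revert hj
    refine Fin.cases ?_ (fun j' => Fin.cases ?_ (fun j'' => j''.elim0) j') j
    · intro hj; exact Or.inl ((congrArg (fun U : M₁.V.Opens => x ∈ U) (hOWeq 0)).mpr hj)
    · intro hj; exact Or.inr ((congrArg (fun U : M₁.V.Opens => x ∈ U) (hOWeq 1)).mpr hj)
  -- the pin `z₀′ · π^*(y₁) = π^*(y₀)`
  have hy0val : ((y 0 : ↥(𝒜 0)) : Γ(X', O.1)) = e₀.symm (X 0) ^ (d * p) := by rw [hyval, ← ha₀]; rfl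
  have hpz : (E 1).symm ⟨_, (hz 1).1⟩ * π₁.appLE O.1 (OW 1).1 (hWle 1) (e'.symm (y 1)) = π₁.appLE O.1 (OW 1).1 (hWle 1) (e'.symm (y 0)) :=
    symm_mul_appLE_eq_of_pin π₁ O.1 (OW 1).1 (hWle 1) (chartNodeGrading ![] 𝒜 (e₀.symm ∘ ![X 0, X 1]) ![2, 1] hf (d * (2 * p)) (y 1) (hy 1)) (E 1) e' (toChartRing 𝒜 (e₀.symm ∘ ![X 0, X 1]) ![2, 1] (d * (2 * p)) (y 1) (hy 1))
      (hpin 1 (hWle 1)) ⟨_, (hz 1).1⟩ (e'.symm (y 0)) (e'.symm (y 1)) (y 0) (y 1) (e'.apply_symm_apply _) (e'.apply_symm_apply _)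
      (a1_section_pin e₀ ![] 𝒜 d (y 0) (y 1) (hy 1) hy0val)
  have htU : ∀ v ∈ (OW 1).1, v ∈ (OW 0).1 → v ∈ M₁.V.basicOpen ((E 1).symm ⟨_, (hz 1).1⟩) := fun v hvW hv0 =>
    mem_basicOpen_of_mem_blowupChart_of_mul_appLE_eq hπ' ⟨O.1, hO⟩ hxJ1 (le_of_eq (hOWeq 1)) _ hpz hvW
      ((congrArg (fun U : M₁.V.Opens => v ∈ U) (hOWeq 0)).mp hv0)
  -- ### the model of the node of `W = OW 1`, opaque
  have hx2 : e₀.symm (X 2) ∈ 𝒜 0 := by rw [h𝒜]; trivial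
  have hyval1 : ((y 1 : ↥(𝒜 0)) : Γ(X', O.1)) = (∏ i : ZMod p, (e₀.symm (X 1) + (i.val : Γ(X', O.1)) * e₀.symm (X 0))) ^ (2 * d) := by
    rw [hyval, ← ha₁]; rfl
  obtain ⟨hh₁, Φ₁, hhh₁, r0, r1, r2, rz, r4, r5, rh, dg0, dgz, dg1, dgs, dgη, hres⟩ :=
    D4.exists_d4NormChartModel σ hC h0 h1 h2 h3 e₀ τ₀ hact₀ hp.pos hσp₀ hσJ ![] 𝒜 hf hx2 d (y 1) hyval1 (hy 1) (hσy 1)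
  letI instP := mapGradedRing (chartNodeGrading ![] 𝒜 (e₀.symm ∘ ![X 0, X 1]) ![2, 1] hf (d * (2 * p)) (y 1) (hy 1)) Φ₁
  -- facts of the free model `P = k[x_none, x′][1/h]`
  have hv : Function.Injective (![some 2, some 0] : Fin 2 → Option (Fin 4)) := by
    intro i j hij; fin_cases i <;> fin_cases j <;> first | rfl | exact absurd hij (by decide)
  have hg : ∀ i, (fun o : Option (Fin 4) => if o = some 1 then (1 : k) else 0) ((![some 2, some 0] : Fin 2 → Option (Fin 4)) i) = 0 := by
    intro i; fin_cases i <;> exact if_neg (by decide)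
  have hu : MvPolynomial.eval (fun o : Option (Fin 4) => if o = some 1 then (1 : k) else 0) hh₁ ≠ 0 := by
    rw [hhh₁]; exact A1.a1m2_eval_h_ne_zero k p d
  haveI hcharP := charP_away_of_eval_ne_zero p hh₁ _ hu
  have hfv : (fun i => algebraMap (MvPolynomial (Option (Fin 4)) k) (Localization.Away hh₁) (X ((![some 2, some 0] : Fin 2 → Option (Fin 4)) i))) =
      ![algebraMap (MvPolynomial (Option (Fin 4)) k) (Localization.Away hh₁) (X (some 2)), algebraMap (MvPolynomial (Option (Fin 4)) k) (Localization.Away hh₁) (X (some 0))] := by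
    funext i; fin_cases i <;> rfl
  have hK1₂ := isRegular_algebraMap_X_away k hh₁ _ hv _ hg hu
  have hK1'₂ := isRegularRing_quotient_X_away k hh₁ (![some 2, some 0] : Fin 2 → Option (Fin 4))
  rw [hfv] at hK1₂ hK1'₂
  have hηη : algebraMap (MvPolynomial (Option (Fin 4)) k) (Localization.Away hh₁) hh₁ * IsLocalization.Away.invSelf hh₁ = 1 := IsLocalization.Away.mul_invSelf hh₁
  have ht : Φ₁ (((E 1) ((E 1).symm ⟨_, (hz 1).1⟩) : ↥(chartNodeGrading ![] 𝒜 (e₀.symm ∘ ![X 0, X 1]) ![2, 1] hf (d * (2 * p)) (y 1) (hy 1) 0)) :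
      ChartRing 𝒜 (e₀.symm ∘ ![X 0, X 1]) ![2, 1] (d * (2 * p)) (y 1) (hy 1)) =
      algebraMap (MvPolynomial (Option (Fin 4)) k) (Localization.Away hh₁) (X (some 0)) ^ (d * p) * IsLocalization.Away.invSelf hh₁ := by
    rw [(E 1).apply_symm_apply]; exact hres (d * p)
  -- the value of the residual section `t` lies in `𝒥₂ = (z, X₀)` of weights `(1, 1)`
  have htJ : algebraMap (MvPolynomial (Option (Fin 4)) k) (Localization.Away hh₁) (X (some 0)) ^ (d * p) * IsLocalization.Away.invSelf hh₁ ∈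
      (weightedFiltration (![algebraMap (MvPolynomial (Option (Fin 4)) k) (Localization.Away hh₁) (X (some 2)), algebraMap (MvPolynomial (Option (Fin 4)) k) (Localization.Away hh₁) (X (some 0))] :
        Fin 2 → Localization.Away hh₁) ![1, 1]).ideal (d * p) := by
    refine Ideal.mul_mem_right _ _ ?_
    have h := Ideal.pow_mem_pow (mem_weightedFiltration_ideal (![algebraMap (MvPolynomial (Option (Fin 4)) k) (Localization.Away hh₁) (X (some 2)), algebraMap (MvPolynomial (Option (Fin 4)) k) (Localization.Away hh₁) (X (some 0))] :
      Fin 2 → Localization.Away hh₁) ![1, 1] 1) (d * p)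
    have hle := Veronese.idealFiltration_pow_le (weightedFiltration (![algebraMap (MvPolynomial (Option (Fin 4)) k) (Localization.Away hh₁) (X (some 2)), algebraMap (MvPolynomial (Option (Fin 4)) k) (Localization.Away hh₁) (X (some 0))] :
      Fin 2 → Localization.Away hh₁) ![1, 1]) 1 (d * p)
    rw [one_mul] at hle
    exact hle h
  -- ### move 2
  obtain ⟨𝒦₂, d₂, hd₂, hadm₂, hmove₂⟩ := d4_move2 hp hG M₁ (OW 1)
    ({ affine := hOWaff 1, m := 0 + 1, r := Fin.cons 0 ![], B := ChartRing 𝒜 (e₀.symm ∘ ![X 0, X 1]) ![2, 1] (d * (2 * p)) (y 1) (hy 1),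
       𝒜 := chartNodeGrading ![] 𝒜 (e₀.symm ∘ ![X 0, X 1]) ![2, 1] hf (d * (2 * p)) (y 1) (hy 1),
       σ := sigmaChart 𝒜 (e₀.symm ∘ ![X 0, X 1]) ![2, 1] (d * (2 * p)) (y 1) (hy 1) τ₀ hσJ hp.pos hσp₀ (hσy 1),
       e := E 1, tame := htame' 1, intertwine := hE 1 } : NodeData p M₁.act g₀ (OW 1))
    Φ₁ (conj Φ₁ (sigmaChart 𝒜 (e₀.symm ∘ ![X 0, X 1]) ![2, 1] (d * (2 * p)) (y 1) (hy 1) τ₀ hσJ hp.pos hσp₀ (hσy 1))) (fun _ => rfl)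
    (algebraMap (MvPolynomial (Option (Fin 4)) k) (Localization.Away hh₁) (X none)) (algebraMap (MvPolynomial (Option (Fin 4)) k) (Localization.Away hh₁) (X (some 0)))
    (algebraMap (MvPolynomial (Option (Fin 4)) k) (Localization.Away hh₁) (X (some 1))) (algebraMap (MvPolynomial (Option (Fin 4)) k) (Localization.Away hh₁) (X (some 2)))
    (algebraMap (MvPolynomial (Option (Fin 4)) k) (Localization.Away hh₁) (X (some 3))) (algebraMap (MvPolynomial (Option (Fin 4)) k) (Localization.Away hh₁) hh₁)
    (IsLocalization.Away.invSelf hh₁) _ r0 r1 r2 rz r4 (r5 _ (Set.mem_union_left _ (Set.mem_singleton _))) hηη r5 (A1.a1_model_closure_eq_top hh₁)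
    (consIndexEquiv ![] ((1 : ℤ), 0)) d hd dgz dg0 dgη hK1₂ hK1'₂ (fun _ : Unit => (OW 0).1) (fun x => (hcovM x).symm.imp_right fun h => ⟨(), h⟩)
    (fun _ : Unit => (E 1).symm ⟨_, (hz 1).1⟩) (fun _ => d * p) (fun _ => hdp) (fun _ => by simpa only [ht] using htJ) (fun _ => htU) 𝔄₁ hF₁W
  refine ⟨𝒦₂, d₂, hadm₂, fun M₂ hm₂ => ⟨⟨NodeAtlasData.ofNodeAtlas (p := p) (ρ := M₂.act) (g₀ := g₀) M₂.atlas⟩, ?_⟩⟩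
  obtain ⟨π₂, hbl₂, -, hr₂, hcomm₂⟩ := hm₂
  haveI : M₂.V.IsSeparated := isSeparated_of_datum φ M₂
  obtain ⟨W₂, 𝔄₂, hF₂, hW₂aff, hle, hf₂, hσJ₂, hσp₂, y₀, hy₀v, hy₀, hσy₀, c₁, hc₁, E₂, W₂', u₂, htame₂, hE₂, hpin₂, hcov₂, hu₂v, hu₂U⟩ :=
    hmove₂ M₂ π₂ hbl₂ hr₂ hcomm₂
  -- ### moves 3 and 4 = the kill, through the second leaf
  have hu₁U : ∀ i : Unit, ∀ v ∈ W₂.1, v ∈ π₂ ⁻¹ᵁ (OW 0).1 → v ∈ M₂.V.basicOpen (π₂.appLE (OW 1).1 W₂.1 hle ((E 1).symm ⟨_, (hz 1).1⟩)) := by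
    intro _ v hvW hvU
    rw [Scheme.basicOpen_appLE]
    exact ⟨hvW, htU (π₂.base v) (hle hvW) hvU⟩
  have hxt : (((E 1).trans (zeroRingEquiv (chartNodeGrading ![] 𝒜 (e₀.symm ∘ ![X 0, X 1]) ![2, 1] hf (d * (2 * p)) (y 1) (hy 1)) Φ₁)) ((E 1).symm ⟨_, (hz 1).1⟩) : Localization.Away hh₁) ∈
      Ideal.span {algebraMap (MvPolynomial (Option (Fin 4)) k) (Localization.Away hh₁) (X (some 0))} := by
    change Φ₁ (((E 1) ((E 1).symm ⟨_, (hz 1).1⟩) : ↥(chartNodeGrading ![] 𝒜 (e₀.symm ∘ ![X 0, X 1]) ![2, 1] hf (d * (2 * p)) (y 1) (hy 1) 0)) : ChartRing 𝒜 (e₀.symm ∘ ![X 0, X 1]) ![2, 1] (d * (2 * p)) (y 1) (hy 1)) ∈ _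
    rw [ht]
    obtain ⟨n, hn⟩ := Nat.exists_eq_succ_of_ne_zero hdp.ne'
    rw [hn, pow_succ, mul_comm _ (algebraMap (MvPolynomial (Option (Fin 4)) k) (Localization.Away hh₁) (X (some 0))), mul_assoc]
    exact Ideal.mul_mem_right _ _ (Ideal.mem_span_singleton_self _)
  exact d4_killsIn_two hp hG (fun M => isSeparated_of_datum φ M) M₂ hh₁ d hd hhh₁ _ _ _ _ _ rfl rfl rfl rfl rfl
    (mapGrading (chartNodeGrading ![] 𝒜 (e₀.symm ∘ ![X 0, X 1]) ![2, 1] hf (d * (2 * p)) (y 1) (hy 1)) Φ₁) (consIndexEquiv ![] ((1 : ℤ), 0))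
    (conj Φ₁ (sigmaChart 𝒜 (e₀.symm ∘ ![X 0, X 1]) ![2, 1] (d * (2 * p)) (y 1) (hy 1) τ₀ hσJ hp.pos hσp₀ (hσy 1)))
    r0 r1 r2 rz r4 r5 rh hσp₂ dg1 dgs dgη d₂ hd₂ W₂ hW₂aff hf₂ hσJ₂ y₀ hy₀v hy₀ hσy₀ c₁ hc₁ E₂ htame₂ hE₂
    (fun _ : Unit => π₂ ⁻¹ᵁ (OW 0).1) W₂' hcov₂ u₂ hu₂v hu₂U (fun _ : Unit => π₂.appLE (OW 1).1 W₂.1 hle ((E 1).symm ⟨_, (hz 1).1⟩))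
    (fun _ : Unit => ((E 1).trans (zeroRingEquiv (chartNodeGrading ![] 𝒜 (e₀.symm ∘ ![X 0, X 1]) ![2, 1] hf (d * (2 * p)) (y 1) (hy 1)) Φ₁)) ((E 1).symm ⟨_, (hz 1).1⟩))
    (fun _ => hxt) (fun _ => hpin₂ _) hu₁U 𝔄₂ hF₂

/-- ★★★ **INSTANCE I-3 OF RECORD (D₄ = MT-D₄ v1.1)**: for the D₄ datum and EVERY node atlas `𝔄₀` on the initial model there is a class `P ∋ (M₀, 𝔄₀)`
of decorated models from every non-terminal member of which a bounded `TreeF` inside `P` reaches `μ_F`-lower decorated models — the conclusion of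
`ReachLowerInF(X)` at `(M₀, 𝔄₀)`. [OURS · L1 W4.5c · R-F15e I-3; NOT a statement of the manuscript] -/
theorem exists_reachLowerF_initial_of_d4 [Finite G] (hp : p.Prime) (hG : ∀ g : G, g ∈ Subgroup.zpowers g₀) (hg₀ : g₀ ^ p = 1)
    (hq : ∀ g : G, (ρ g).hom ≫ q = q) [IsIntegral X'] [IsLocallyNoetherian X'] [X'.IsSeparated] [IsAffine X']
    (hreg : Scheme.IsRegular X') {k' : Type} [Field k'] (φ : X₁ ⟶ Spec (.of k')) [IsSeparated φ] [LocallyOfFiniteType φ] [IsFinite q]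
    {k : Type} [Field k] [CharP k p] (σ : MvPolynomial (Fin 4) k ≃+* MvPolynomial (Fin 4) k) (hC : ∀ a : k, σ (C a) = C a)
    (h0 : σ (X 0) = X 0) (h1 : σ (X 1) = X 1 + X 0) (h2 : σ (X 2) = X 2 + X 0) (h3 : σ (X 3) = X 3 + X 1 * (X 2 * (X 1 - X 2)))
    (e : Γ(X', ⊤) ≃+* MvPolynomial (Fin 4) k)
    (hστ : ∀ t : Γ(X', ⊤), e ((ρ g₀⁻¹).hom.appLE ⊤ ⊤ (by rw [Scheme.Hom.preimage_top]) t) = σ (e t))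
    (h₀ : NodeAtlas p (⟨ρ, hq⟩ : ActionOver q G) g₀) (𝔄₀ : NodeAtlasData p (GModel.initial hq h₀).act g₀) :
    ∃ P : ∀ M : GModel p q G ρ g₀, NodeAtlasData p M.act g₀ → Prop,
      P (GModel.initial hq h₀) 𝔄₀ ∧ ∀ (M : GModel p q G ρ g₀) (𝔄 : NodeAtlasData p M.act g₀), P M 𝔄 → ¬ M.Terminal →
        ∃ n : ℕ, TreeF P (fun N 𝔅 => LexLTF N 𝔅 M 𝔄) n M 𝔄 :=
  exists_reachLowerF_of_killsIn_datum hp hG φ (GModel.initial hq h₀) 𝔄₀ (d4_killsIn_four hp hG hg₀ hq hreg φ σ hC h0 h1 h2 h3 e hστ h₀)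

end Summit.ResolutionOfSingularities.ResolutionOfSingularities.Theorems.WildQuotientResolution.S1.GameFrame.GModel

end
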